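import Summits.QuantumFields.YangMills.Theorems.ForcedResponseSkewnessRunningCouplingCeilingSmearUniformToolkit
import HarnessLib

/-!
# Crux `RunningCouplingCeiling` (repaired, stmt-QuantumFields-24275), line «pointwise-log-ceiling-r»: registered stub
# `stub_smearUniform` — the smeared ceiling with ONE constant for all normalised sources in a positive-time ball

Support file (`--supports stmt-QuantumFields-24275`) of the lead prover of route `ForcedResponseSkewness` (unit
`ym-line-frs-p1`).  `SmearUniformSig` (`Theorems/ForcedResponseSkewnessRunningCouplingCeilingDefs.lean`): for a base point `p`
and radius `0 < ρ₀ < p₀` and kernel constants `C₀ C₁ C₂ n₀` there is `C` such that for every real Schwartz `v` with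
`tsupport v ⊆ closedBall p ρ₀`, `∫|v| ≤ 1`, every `Λ ≥ 2`, with per-source thresholds `t₀`, `Λ₆`: for `0 < t ≤ t₀`, tori
`t·L ≥ Λ₆`, kernels `K` with `KernelBounds C₀ C₁ C₂ n₀ t L K` and `l ∈ [Λ, 2Λ]`,
`Σ_{x,y ∈ box L} θv((l t) x) v((l t) y) K x y ≤ C / log² Λ`.

Proof.  The supports of `θv` and `v` are `σ₀ = 2(p₀ − ρ₀)`-separated in time and bounded by `R = ‖p‖ + ρ₀`: every pair with
a non-zero term has torus distance `d ≥ σ₀/s` (`s = l t`; no wrap-around once `sL ≥ 2(p₀+ρ₀)`), so for `s < σ₀/n₀` the contact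
class is empty; in the infrared class `|K| ≤ 2⁸C₁t⁸`; in the window `|K| ≤ 4C₀(s/σ₀)⁸/log²Λ` when `Λ ≥ 4R²` (`t d ≤ 2R/l ≤ 1/√Λ`)
and `|K| ≤ C₁(s/σ₀)⁸ ≤ C₁(s/σ₀)⁸ log²Λ*/log²Λ` otherwise (`Λ* = 4R² + 2`).  The Riemann sums `s⁴ Σ |v(s x)| ≤ 2`,
`s⁴ Σ |θv(s x)| ≤ 2` for `s ≤ s₀(v)` (`riemann_abs_le_two`: the lattice step function of `|v|` is dominated by
`|v| + 4Da·1_{ball}`, `D` a Lipschitz constant of `v`; tree cell toolkit `…NPointIsotropyRiemannSum`) finish with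
`1/l⁸ ≤ 1/log²Λ`.  No wall flatness is needed.

Honest label: the analysis half of a conditional rung line (leaf R2a `BalabanLadder.NT`); nothing here bears on the
Yang–Mills mass gap, which is NOT proved by this.
-/

set_option autoImplicit false

noncomputable section

namespace Summit.QuantumFields.YangMills.Cruxes.RunningCouplingCeiling.Pointwise

open Set Metric MeasureTheory Filter Topology Finset
open scoped SchwartzMap
open Literature.MathematicalPhysics.QuantumLattice Literature.Probability.LatticeModels

/-! ### The per-pair estimate (no flatness: supports are `2(p₀−ρ₀)`-separated in time) -/

/-- **Per-pair majorant for a source in a positive-time ball.**  For `v` with `tsupport v ⊆ closedBall p ρ₀` (`ρ₀ < p₀`),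
spacing `s = l t` with `s (n₀+1) ≤ 2(p₀−ρ₀)` and no wrap-around `2(p₀+ρ₀) ≤ sL`, kernel bounds at unit `t`, window `Λ ≤ l`:
every term is at most `|θv(s x)| |v(s y)| · M` with the pair-independent weight
`M = 2⁸C₁⁺t⁸ + (4C₀⁺ + C₁⁺ log²(4(‖p‖+ρ₀)²+2)) s⁸ / ((2(p₀−ρ₀))⁸ log²Λ)`. [folklore] -/
theorem pair_le_uniform (v : 𝓢(EuclideanSpace ℝ (Fin 4), ℝ)) {p : EuclideanSpace ℝ (Fin 4)} {ρ₀ : ℝ}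
    (hρ₀ : 0 ≤ ρ₀) (hρp : ρ₀ < p 0) (hvball : tsupport (v : EuclideanSpace ℝ (Fin 4) → ℝ) ⊆ closedBall p ρ₀)
    (C₀ C₁ C₂ : ℝ) (n₀ : ℕ) {Λ t l s : ℝ} (hΛ : 2 ≤ Λ) (ht : 0 < t) (hl1 : Λ ≤ l) (hs : s = l * t)
    (hsσ : s * ((n₀ : ℝ) + 1) ≤ 2 * (p 0 - ρ₀)) (L : ℕ) (hsL : 2 * (p 0 + ρ₀) ≤ s * L)
    (K : (Fin 4 → ℤ) → (Fin 4 → ℤ) → ℝ) (hK : KernelBounds C₀ C₁ C₂ n₀ t L K)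
    (x y : Fin 4 → ℤ) (hx : x ∈ box 4 L) (hy : y ∈ box 4 L) :
    (thetaTest 4 v) (s • siteToE x) * v (s • siteToE y) * K x y ≤
      |(thetaTest 4 v) (s • siteToE x)| * |v (s • siteToE y)| *
        (2 ^ 8 * max C₁ 0 * t ^ 8 + (4 * max C₀ 0 + max C₁ 0 * Real.log (4 * (‖p‖ + ρ₀) ^ 2 + 2) ^ 2) * s ^ 8 /
          ((2 * (p 0 - ρ₀)) ^ 8 * Real.log Λ ^ 2)) := by
  set σ₀ : ℝ := 2 * (p 0 - ρ₀) with hσ₀def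
  have hσ₀ : 0 < σ₀ := by rw [hσ₀def]; linarith
  set R : ℝ := ‖p‖ + ρ₀ with hRdef
  set Λs : ℝ := 4 * R ^ 2 + 2 with hΛs
  have hΛs2 : 2 ≤ Λs := by rw [hΛs]; nlinarith [sq_nonneg R]
  set C₀' : ℝ := max C₀ 0 with hC₀'
  set C₁' : ℝ := max C₁ 0 with hC₁'
  have hC₀'0 : 0 ≤ C₀' := le_max_right _ _
  have hC₁'0 : 0 ≤ C₁' := le_max_right _ _
  set W : ℝ := 4 * C₀' + C₁' * Real.log Λs ^ 2 with hW
  have hΛpos : 0 < Λ := by linarith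
  have hlog : 0 < Real.log Λ := Real.log_pos (by linarith)
  have hlpos : 0 < l := by linarith
  have hspos : 0 < s := by rw [hs]; exact mul_pos hlpos ht
  set M : ℝ := 2 ^ 8 * C₁' * t ^ 8 + W * s ^ 8 / (σ₀ ^ 8 * Real.log Λ ^ 2) with hM
  have hMa : 0 ≤ 2 ^ 8 * C₁' * t ^ 8 := by positivity
  have hMb : 0 ≤ W * s ^ 8 / (σ₀ ^ 8 * Real.log Λ ^ 2) := by positivity
  set u : EuclideanSpace ℝ (Fin 4) := s • siteToE x with hu
  set w : EuclideanSpace ℝ (Fin 4) := s • siteToE y with hw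
  show (thetaTest 4 v) u * v w * K x y ≤ |(thetaTest 4 v) u| * |v w| * M
  refine (le_abs_self _).trans ?_
  rw [abs_mul, abs_mul]
  by_cases hvu : (thetaTest 4 v) u = 0
  · rw [hvu, abs_zero, zero_mul, zero_mul, zero_mul]
  by_cases hvw : v w = 0
  · rw [hvw, abs_zero, mul_zero, zero_mul, zero_mul]
  refine mul_le_mul_of_nonneg_left ?_ (mul_nonneg (abs_nonneg _) (abs_nonneg _))
  -- geometry of the pair
  have hwg := support_geometry hvball hvw
  have hug : p 0 - ρ₀ ≤ -u 0 ∧ -u 0 ≤ p 0 + ρ₀ ∧ ‖u‖ ≤ R := by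
    rw [thetaTest_apply] at hvu
    have h := support_geometry hvball hvu
    have h0 : (timeReflection 4 u) 0 = -u 0 := by simp
    rw [h0, LinearIsometryEquiv.norm_map] at h
    exact h
  obtain ⟨hu1, hu2, huR⟩ := hug
  obtain ⟨hw1, hw2, hwR⟩ := hwg
  set d : ℝ := torusDist L x y with hd
  have hu0x : u 0 = s * (x 0 : ℝ) := by rw [hu, PiLp.smul_apply, siteToE_apply, smul_eq_mul]
  have hw0y : w 0 = s * (y 0 : ℝ) := by rw [hw, PiLp.smul_apply, siteToE_apply, smul_eq_mul]
  have hσle : σ₀ ≤ w 0 - u 0 := by rw [hσ₀def]; linarith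
  have hσge : w 0 - u 0 ≤ 2 * (p 0 + ρ₀) := by linarith
  have hdiff : w 0 - u 0 = s * |((x 0 - y 0 : ℤ) : ℝ)| := by
    have h1 : s * ((y 0 : ℝ) - (x 0 : ℝ)) = w 0 - u 0 := by rw [hu0x, hw0y]; ring
    have h2 : 0 < s * ((y 0 : ℝ) - (x 0 : ℝ)) := by rw [h1]; linarith
    have h3 : 0 < (y 0 : ℝ) - (x 0 : ℝ) := (mul_pos_iff_of_pos_left hspos).1 h2
    push_cast
    rw [abs_of_neg (by linarith), hu0x, hw0y]; ring
  have hxyL : |x 0 - y 0| ≤ (L : ℤ) := by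
    have h1 : s * |((x 0 - y 0 : ℤ) : ℝ)| ≤ s * L := by rw [← hdiff]; exact hσge.trans hsL
    exact_mod_cast le_of_mul_le_mul_left h1 hspos
  have hσd : σ₀ ≤ s * d := by
    calc σ₀ ≤ w 0 - u 0 := hσle
      _ = s * |((x 0 - y 0 : ℤ) : ℝ)| := hdiff
      _ ≤ s * d := mul_le_mul_of_nonneg_left (by exact_mod_cast abs_sub_le_torusDist L x y hxyL) hspos.le
  have hdpos : 0 < d := by
    by_contra h
    rw [not_lt] at h
    have := mul_nonpos_of_nonneg_of_nonpos hspos.le h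
    linarith
  -- no contact class
  have hdn : (n₀ : ℝ) ≤ d := by
    have h2 : s * (n₀ : ℝ) < s * d := by nlinarith
    exact (lt_of_mul_lt_mul_left h2 hspos.le).le
  obtain ⟨-, hK1, hK0⟩ := hK x hx y hy
  have hK1' : d ^ 8 * |K x y| ≤ C₁' := (hK1 hdn).trans (le_max_left _ _)
  rcases lt_or_ge (1 / 2 : ℝ) (t * d) with htd | htd
  · -- infrared
    have h2t : 1 / d ≤ 2 * t := by rw [div_le_iff₀ hdpos]; linarith
    calc |K x y| ≤ C₁' / d ^ 8 := by rw [le_div_iff₀ (by positivity), mul_comm]; exact hK1'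
      _ = C₁' * (1 / d) ^ 8 := by rw [div_pow, one_pow, ← div_eq_mul_one_div]
      _ ≤ C₁' * (2 * t) ^ 8 := mul_le_mul_of_nonneg_left (pow_le_pow_left₀ (by positivity) h2t 8) hC₁'0
      _ = 2 ^ 8 * C₁' * t ^ 8 := by ring
      _ ≤ M := by rw [hM]; linarith
  · -- window
    have hsf : |K x y| ≤ C₁' * (s / σ₀) ^ 8 := kernel_le_of_pow_mul_le hdpos hσ₀ hσd hC₁'0 hK1'
    have hR0 : 0 ≤ R := by rw [hRdef]; positivity
    have hduw : d * s ≤ 2 * R := by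
      calc d * s = s * torusDist L x y := by rw [hd, mul_comm]
        _ ≤ s * ‖siteToE x - siteToE y‖ :=
            mul_le_mul_of_nonneg_left (torusDist_le_norm_sub L x y) hspos.le
        _ = ‖u - w‖ := by rw [hu, hw, ← smul_sub, norm_smul, Real.norm_eq_abs, abs_of_pos hspos]
        _ ≤ ‖u‖ + ‖w‖ := norm_sub_le _ _
        _ ≤ 2 * R := by linarith
    have hkey : |K x y| ≤ W * (s / σ₀) ^ 8 / Real.log Λ ^ 2 := by
      rw [hW, hΛs]
      exact window_kernel_le hΛ hR0 ht hdpos hl1 hs hduw hσ₀ hσd (hK0 hdn htd) (le_max_left _ _) hC₀'0 hC₁'0 hsf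
    calc |K x y| ≤ W * (s / σ₀) ^ 8 / Real.log Λ ^ 2 := hkey
      _ = W * s ^ 8 / (σ₀ ^ 8 * Real.log Λ ^ 2) := by rw [div_pow, mul_div_assoc', div_div]
      _ ≤ M := by rw [hM]; linarith

/-! ### The registered stub -/

/-- **Registered stub `stub_smearUniform` of line «pointwise-log-ceiling-r»** (repaired crux `RunningCouplingCeiling`,
stmt-QuantumFields-24275): the smeared ceiling with ONE constant for all L¹-normalised sources in `closedBall p ρ₀`
(`ρ₀ < p₀`), thresholds `t₀ = min(s₀(v), s₀(θv), σ₀/(n₀+1))/(2Λ)`, `Λ₆ = p₀ + ρ₀ + 1`. [folklore] -/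
theorem stub_smearUniform : SmearUniformSig := by
  intro p ρ₀ hρ₀ hρp C₀ C₁ C₂ n₀
  set σ₀ : ℝ := 2 * (p 0 - ρ₀) with hσ₀def
  have hσ₀ : 0 < σ₀ := by rw [hσ₀def]; linarith
  set R : ℝ := ‖p‖ + ρ₀ with hRdef
  have hR0 : 0 ≤ R := by positivity
  set C₀' : ℝ := max C₀ 0 with hC₀'
  set C₁' : ℝ := max C₁ 0 with hC₁'
  have hC₀'0 : 0 ≤ C₀' := le_max_right _ _
  have hC₁'0 : 0 ≤ C₁' := le_max_right _ _
  set W : ℝ := 4 * C₀' + C₁' * Real.log (4 * R ^ 2 + 2) ^ 2 with hW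
  have hW0 : 0 ≤ W := by positivity
  refine ⟨2 ^ 10 * C₁' + 4 * W / σ₀ ^ 8, fun v hvball hvL1 Λ hΛ => ?_⟩
  have hΛpos : 0 < Λ := by linarith
  have hΛ1 : 1 ≤ Λ := by linarith
  have hlog : 0 < Real.log Λ := Real.log_pos (by linarith)
  -- Riemann thresholds for `v` and `θv`
  have hvs : ∀ z, v z ≠ 0 → ‖z‖ ≤ R := fun z hz => (support_geometry hvball hz).2.2
  have hθs : ∀ z, (thetaTest 4 v) z ≠ 0 → ‖z‖ ≤ R := by
    intro z hz
    rw [thetaTest_apply] at hz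
    have h := (support_geometry hvball hz).2.2
    rwa [LinearIsometryEquiv.norm_map] at h
  obtain ⟨a₁, ha₁, hRv⟩ := riemann_abs_le_two v hvs hvL1
  obtain ⟨a₂, ha₂, hRθ⟩ := riemann_abs_le_two (thetaTest 4 v) hθs (by rw [integral_abs_thetaTest]; exact hvL1)
  -- thresholds
  set m : ℝ := min (min a₁ a₂) (σ₀ / ((n₀ : ℝ) + 1)) with hm
  have hm0 : 0 < m := lt_min (lt_min ha₁ ha₂) (by positivity)
  refine ⟨m / (2 * Λ), p 0 + ρ₀ + 1, by positivity, ?_⟩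
  intro t ht htt L hL K hK l hl
  obtain ⟨hl1, hl2⟩ := hl
  have hlpos : 0 < l := by linarith
  set s : ℝ := l * t with hs
  have hspos : 0 < s := mul_pos hlpos ht
  have hsm : s ≤ m := by
    calc s = l * t := hs
      _ ≤ (2 * Λ) * (m / (2 * Λ)) := mul_le_mul hl2 htt ht.le (by positivity)
      _ = m := by field_simp
  have hs1 : s ≤ a₁ := hsm.trans ((min_le_left _ _).trans (min_le_left _ _))
  have hs2 : s ≤ a₂ := hsm.trans ((min_le_left _ _).trans (min_le_right _ _))
  have hsσ : s * ((n₀ : ℝ) + 1) ≤ 2 * (p 0 - ρ₀) := by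
    have h := hsm.trans (min_le_right _ _)
    rwa [le_div_iff₀ (by positivity)] at h
  have hsL : 2 * (p 0 + ρ₀) ≤ s * L := by
    calc 2 * (p 0 + ρ₀) ≤ 2 * (p 0 + ρ₀ + 1) := by linarith
      _ ≤ l * (t * L) := mul_le_mul (by linarith) hL (by linarith) hlpos.le
      _ = s * L := by rw [hs]; ring
  -- the pair-independent weight
  set M : ℝ := 2 ^ 8 * C₁' * t ^ 8 + W * s ^ 8 / (σ₀ ^ 8 * Real.log Λ ^ 2) with hM
  have hM0 : 0 ≤ M := by positivity
  have hpair : ∀ x ∈ box 4 L, ∀ y ∈ box 4 L,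
      (thetaTest 4 v) (s • siteToE x) * v (s • siteToE y) * K x y ≤
        |(thetaTest 4 v) (s • siteToE x)| * |v (s • siteToE y)| * M := fun x hx y hy =>
    pair_le_uniform v hρ₀.le hρp hvball C₀ C₁ C₂ n₀ hΛ ht hl1 hs hsσ L hsL K hK x y hx hy
  -- Riemann sums
  have hRv' : ∑ y ∈ box 4 L, |v (s • siteToE y)| ≤ 2 * (s ^ 4)⁻¹ := by
    have h := hRv s hspos hs1 L
    have h' : ∑ y ∈ box 4 L, |v (s • siteToE y)| ≤ 2 / s ^ 4 := (le_div_iff₀' (by positivity)).2 h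
    simpa [div_eq_mul_inv] using h'
  have hRθ' : ∑ x ∈ box 4 L, |(thetaTest 4 v) (s • siteToE x)| ≤ 2 * (s ^ 4)⁻¹ := by
    have h := hRθ s hspos hs2 L
    have h' : ∑ x ∈ box 4 L, |(thetaTest 4 v) (s • siteToE x)| ≤ 2 / s ^ 4 :=
      (le_div_iff₀' (by positivity)).2 h
    simpa [div_eq_mul_inv] using h'
  have hsum : ∑ x ∈ box 4 L, ∑ y ∈ box 4 L, (thetaTest 4 v) (s • siteToE x) * v (s • siteToE y) * K x y ≤
      (2 * (s ^ 4)⁻¹) * (2 * (s ^ 4)⁻¹) * M := by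
    calc ∑ x ∈ box 4 L, ∑ y ∈ box 4 L, (thetaTest 4 v) (s • siteToE x) * v (s • siteToE y) * K x y
        ≤ ∑ x ∈ box 4 L, ∑ y ∈ box 4 L, |(thetaTest 4 v) (s • siteToE x)| * |v (s • siteToE y)| * M :=
          Finset.sum_le_sum fun x hx => Finset.sum_le_sum fun y hy => hpair x hx y hy
      _ = (∑ x ∈ box 4 L, |(thetaTest 4 v) (s • siteToE x)|) * (∑ y ∈ box 4 L, |v (s • siteToE y)|) * M := by
          rw [Finset.sum_mul_sum, Finset.sum_mul]
          refine Finset.sum_congr rfl fun x _ => ?_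
          rw [Finset.sum_mul]
      _ ≤ (2 * (s ^ 4)⁻¹) * (2 * (s ^ 4)⁻¹) * M := by
          apply mul_le_mul_of_nonneg_right _ hM0
          exact mul_le_mul hRθ' hRv' (Finset.sum_nonneg fun _ _ => abs_nonneg _) (by positivity)
  refine hsum.trans ?_
  -- constants: `4 s⁻⁸ M = 2^10 C₁'/l⁸ + 4W/(σ₀⁸ log²Λ) ≤ C/log²Λ`
  have hlogΛ2 : Real.log Λ ^ 2 ≤ Λ ^ 2 := log_sq_le_sq hΛ1
  have hΛ2le8 : Λ ^ 2 ≤ Λ ^ 8 := pow_le_pow_right₀ hΛ1 (by norm_num)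
  have hs80 : 0 < s ^ 8 := by positivity
  have hl8 : t ^ 8 * (s ^ 8)⁻¹ ≤ 1 / Real.log Λ ^ 2 := by
    have h1 : t ^ 8 * (s ^ 8)⁻¹ = 1 / l ^ 8 := by rw [hs, mul_pow]; field_simp
    rw [h1]
    calc 1 / l ^ 8 ≤ 1 / Λ ^ 8 :=
          div_le_div_of_nonneg_left zero_le_one (by positivity) (pow_le_pow_left₀ hΛpos.le hl1 8)
      _ ≤ 1 / Real.log Λ ^ 2 := div_le_div_of_nonneg_left zero_le_one (by positivity) (hlogΛ2.trans hΛ2le8)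
  have hss : (s ^ 4)⁻¹ * (s ^ 4)⁻¹ = (s ^ 8)⁻¹ := by rw [← mul_inv, ← pow_add]
  have hcancel : s ^ 8 * (s ^ 8)⁻¹ = 1 := mul_inv_cancel₀ hs80.ne'
  have e : (2 * (s ^ 4)⁻¹) * (2 * (s ^ 4)⁻¹) * M =
      2 ^ 10 * C₁' * (t ^ 8 * (s ^ 8)⁻¹) + 4 * W / σ₀ ^ 8 * ((s ^ 8 * (s ^ 8)⁻¹) / Real.log Λ ^ 2) := by
    rw [show (2 * (s ^ 4)⁻¹) * (2 * (s ^ 4)⁻¹) = 4 * ((s ^ 4)⁻¹ * (s ^ 4)⁻¹) by ring, hss, hM]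
    ring
  rw [e, hcancel]
  have h1 : 2 ^ 10 * C₁' * (t ^ 8 * (s ^ 8)⁻¹) ≤ 2 ^ 10 * C₁' * (1 / Real.log Λ ^ 2) :=
    mul_le_mul_of_nonneg_left hl8 (by positivity)
  have e2 : (2 ^ 10 * C₁' + 4 * W / σ₀ ^ 8) / Real.log Λ ^ 2 =
      2 ^ 10 * C₁' * (1 / Real.log Λ ^ 2) + 4 * W / σ₀ ^ 8 * (1 / Real.log Λ ^ 2) := by ring
  rw [e2]
  linarith

end Summit.QuantumFields.YangMills.Cruxes.RunningCouplingCeiling.Pointwise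

end
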